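import Literature.RingTheory.MvPolynomial.EquidimensionalHilbert
import HarnessLib

/-!
# Bézout-type counting of the top-dimensional relevant components of an ideal generated by forms
# of bounded degree

Topic: `Literature/RingTheory/MvPolynomial`. Let `𝔞 ⊆ S = K[X_0, …, X_{m-1}]` (`K` an infinite
field) be an ideal generated by forms of degree `≤ D` (`D ≥ 1`). Call a prime RELEVANT (to the
torus `G = {x_0 ⋯ x_{m-1} ≠ 0}`) if it contains no variable. If every relevant minimal prime of `𝔞`
has `dim S/𝔭 ≤ a + 1`, then **the number of relevant minimal primes of `𝔞` with `dim S/𝔭 = a + 1`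
is at most `D^{m - (a+1)}`** (`card_le_pow_of_relevant_minimalPrimes`).

This is the special case `G = 𝔾ₘ^{m-1} ⊂ ℙ^{m-1}`, `𝔊 = (0)`, of Nesterenko–Philippon (eds.),
LNM 1752, Ch. 11 (D. Roy), Prop. 2.2 ("`𝓗(I; D) ≤ 𝓗(G; D) = D^{m-1}` for `I = (𝔊, S)^*`, `S` forms
of degree `≤ D`"), read through §2.2 (ii) (`𝓗(I; D) ≥ Σ_{top components} 𝓗(𝔭; D) ≥ N · D^{a}`),
and of the first inequality of Philippon, Bull. SMF 114 (1986), Prop. 3.3; it is proved here along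
the lines of loc. cit. but for the RADICALS of the successive hypersurface sections, which makes
I. S. Cohen's unmixedness theorem unnecessary: starting from `K_0 = (0)` one cuts `i` times by a
form `Q_{i+1} ∈ 𝔞_D` avoiding the primes of `K_i` (possible while `dim > a + 1`, by maximality of
`a + 1` among relevant minimal primes of `𝔞`; `exists_mem_forall_notMem_of_forall_not_le`), and
lets `K_{i+1}` be the intersection of the relevant minimal primes of `K_i + (Q_{i+1})` of dimension
`dim K_i - 1`; every relevant top-dimensional minimal prime of `𝔞` contains a prime of each `K_i`
(Krull's principal ideal theorem and catenarity,
`ringKrullDim_quotient_add_one_of_mem_minimalPrimes_sup_span`), the leading coefficients of the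
Hilbert polynomials satisfy `lc(P_{K_{i+1}}) ≤ D · deg · lc(P_{K_i})` (Bézout's Lemma,
`leadingCoeff_hilbertPolynomial_le_of_hypersurface`), and at the end the primes being counted are
among those of `K_{m-a-1}`, whose number is bounded through `coeff_a ≥ N/a!`
(`card_mul_inv_factorial_le_coeff`).

## References

* Yu. V. Nesterenko, P. Philippon (eds.), *Introduction to Algebraic Independence Theory*,
  LNM 1752 (2001), Ch. 11 (D. Roy), §2.2 and Prop. 2.2. [NesterenkoPhilippon2001]
* P. Philippon, *Lemmes de zéros dans les groupes algébriques commutatifs*, Bull. Soc. Math.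
  France 114 (1986), Prop. 3.3. [Philippon1986]
-/

noncomputable section

open Module Polynomial

attribute [local instance] MvPolynomial.gradedAlgebra

namespace Literature.RingTheory.MvPolynomial

variable {K : Type*} [Field K] {m : ℕ}

local notation "hilb(" I ", " t ")" =>
  (Module.finrank K (MvPolynomial.homogeneousSubmodule (Fin m) K t) -
    Module.finrank K (idealDegree I t))

/-- The zero ideal of `S = K[X_0, …, X_{m-1}]` (`m ≥ 1`): prime, homogeneous, relevant, of
dimension `m`, with Hilbert polynomial of degree `m - 1` and leading coefficient `1/(m-1)!`.
[folklore] -/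
theorem hilbertPolynomial_bot (hm : 1 ≤ m) :
    ∃ (P : ℚ[X]), (∀ t : ℕ, ((hilb((⊥ : Ideal (MvPolynomial (Fin m) K)), t) : ℕ) : ℚ) =
      P.eval (t : ℚ)) ∧ P.natDegree = m - 1 ∧
      P.leadingCoeff = ((((m - 1).factorial : ℕ) : ℚ)⁻¹) := by
  refine ⟨Polynomial.C ((((m - 1).factorial : ℕ) : ℚ)⁻¹) * (ascPochhammer ℚ (m - 1)).comp (X + 1),
    fun t => ?_, (natDegree_leadingCoeff_hilbertPolynomial_top m).1,
    (natDegree_leadingCoeff_hilbertPolynomial_top m).2⟩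
  rw [idealDegree_bot, finrank_bot, Nat.sub_zero]
  exact finrank_homogeneousSubmodule_eq_eval m t hm

/-- `dim S/(0) = m`. [folklore] -/
theorem ringKrullDim_quotient_bot_mvPolynomial :
    ringKrullDim (MvPolynomial (Fin m) K ⧸ (⊥ : Ideal (MvPolynomial (Fin m) K))) = m := by
  rw [ringKrullDim_eq_of_ringEquiv (RingEquiv.quotientBot _), ringKrullDim_mvPolynomial_fin]

/-- Arithmetic of the induction (kept outside the main proof). [folklore] -/
theorem coneCount_arith {m a r i : ℕ} (hr : r = m - (a + 1)) (hi : i + 1 ≤ r) :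
    a + 2 ≤ m - i ∧ m - i = (m - (i + 1)) + 1 ∧ m - (i + 1) = (m - (i + 1) - 1) + 1 ∧
      1 ≤ m - i - 1 ∧ m - (i + 1) - 1 = m - i - 1 - 1 ∧ m - i - 1 = (m - (i + 1) - 1) + 1 := by
  omega

/-- **Bézout-type bound for the number of top-dimensional relevant components** (LNM 1752 Ch. 11
Prop. 2.2 with §2.2 (ii), case `G = 𝔾ₘ^{m-1}`, `𝔊 = 0`; Philippon 1986 Prop. 3.3, first
inequality): let `𝔞 ⊆ K[X_0, …, X_{m-1}]` (`K` infinite) be generated by forms of degree `≤ D`,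
`D ≥ 1`; suppose every minimal prime of `𝔞` containing no variable has `dim S/𝔭 ≤ a + 1`. Then any
finite set `𝓟` of minimal primes of `𝔞` containing no variable and with `dim S/𝔭 = a + 1` has
`|𝓟| ≤ D^{m - (a + 1)}`. [cite: NesterenkoPhilippon2001, Ch. 11 Prop. 2.2] -/
theorem card_le_pow_of_relevant_minimalPrimes [Infinite K] {D a : ℕ} (hD : 1 ≤ D)
    {𝔞 : Ideal (MvPolynomial (Fin m) K)} {G : Set (MvPolynomial (Fin m) K)} (hG : 𝔞 = Ideal.span G)
    (hGdeg : ∀ g ∈ G, ∃ k, k ≤ D ∧ g.IsHomogeneous k)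
    (hmax : ∀ 𝔭 ∈ 𝔞.minimalPrimes, (∀ i, (MvPolynomial.X i : MvPolynomial (Fin m) K) ∉ 𝔭) →
      ringKrullDim (MvPolynomial (Fin m) K ⧸ 𝔭) ≤ (a + 1 : ℕ))
    (𝓟 : Finset (Ideal (MvPolynomial (Fin m) K)))
    (h𝓟 : ∀ 𝔓 ∈ 𝓟, 𝔓 ∈ 𝔞.minimalPrimes ∧ (∀ i, (MvPolynomial.X i : MvPolynomial (Fin m) K) ∉ 𝔓) ∧
      ringKrullDim (MvPolynomial (Fin m) K ⧸ 𝔓) = (a + 1 : ℕ)) :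
    𝓟.card ≤ D ^ (m - (a + 1)) := by
  classical
  rcases 𝓟.eq_empty_or_nonempty with h𝓟e | ⟨𝔓₀, h𝔓₀⟩
  · simp [h𝓟e]
  -- `a + 1 ≤ m`
  have ham : a + 1 ≤ m := by
    obtain ⟨h1, -, h3⟩ := h𝓟 𝔓₀ h𝔓₀
    obtain ⟨n, hn, hnm⟩ := exists_nat_ringKrullDim_quotient_eq (K := K) h1.1.1.ne_top
    rw [hn] at h3
    have : n = a + 1 := by exact_mod_cast h3
    omega
  have hm : 0 < m := by omega
  obtain ⟨r, hr⟩ : ∃ r, r = m - (a + 1) := ⟨_, rfl⟩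
  rw [← hr]
  have h𝔞hom : 𝔞.IsHomogeneous (MvPolynomial.homogeneousSubmodule (Fin m) K) := by
    rw [hG]
    refine Ideal.homogeneous_span _ _ fun g hg => ?_
    obtain ⟨k, -, hk⟩ := hGdeg g hg
    exact ⟨k, hk⟩
  -- the invariant of the construction `K_i = ⋂ 𝓠_i`
  have key : ∀ i : ℕ, i ≤ r → ∃ 𝓠 : Finset (Ideal (MvPolynomial (Fin m) K)),
      𝓠.Nonempty ∧
      (∀ 𝔮 ∈ 𝓠, 𝔮.IsPrime ∧ 𝔮.IsHomogeneous (MvPolynomial.homogeneousSubmodule (Fin m) K) ∧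
        (∀ j, (MvPolynomial.X j : MvPolynomial (Fin m) K) ∉ 𝔮) ∧
        ringKrullDim (MvPolynomial (Fin m) K ⧸ 𝔮) = (m - i : ℕ)) ∧
      (∀ 𝔓 ∈ 𝓟, ∃ 𝔮 ∈ 𝓠, 𝔮 ≤ 𝔓) ∧
      ∃ (P : ℚ[X]) (t₀ : ℕ), (∀ t, t₀ ≤ t → ((hilb(𝓠.inf id, t) : ℕ) : ℚ) = P.eval (t : ℚ)) ∧
        P.natDegree = m - i - 1 ∧
        P.leadingCoeff ≤ (D : ℚ) ^ i * ((((m - i - 1).factorial : ℕ) : ℚ)⁻¹) := by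
    intro i
    induction i with
    | zero =>
      intro _
      obtain ⟨P, hP, hPdeg, hPlc⟩ := hilbertPolynomial_bot (K := K) (by omega : 1 ≤ m)
      refine ⟨{⊥}, Finset.singleton_nonempty _, ?_, ?_, P, 0, ?_, by simpa using hPdeg, ?_⟩
      · intro 𝔮 h𝔮
        rw [Finset.mem_singleton] at h𝔮
        subst h𝔮
        refine ⟨Ideal.isPrime_bot, Ideal.IsHomogeneous.bot _, fun j hj => ?_, ?_⟩
        · exact MvPolynomial.X_ne_zero j (Ideal.mem_bot.mp hj)
        · rw [Nat.sub_zero]; exact ringKrullDim_quotient_bot_mvPolynomial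
      · intro 𝔓 _
        exact ⟨⊥, Finset.mem_singleton_self _, bot_le⟩
      · intro t _
        rw [Finset.inf_singleton, id]
        exact hP t
      · rw [hPlc, pow_zero, one_mul, Nat.sub_zero]
    | succ i ih =>
      intro hi
      have hi' : i ≤ r := Nat.le_of_succ_le hi
      obtain ⟨hmi, hA2, hA3, hA4, hA5, hA6⟩ := coneCount_arith hr hi
      obtain ⟨𝓠, h𝓠ne, h𝓠, hcov, P, t₀, hP, hPdeg, hPlc⟩ := ih hi'
      -- `𝔞 ⊄ 𝔮` for `𝔮 ∈ 𝓠`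
      have hnot : ∀ 𝔮 ∈ 𝓠, ¬ 𝔞 ≤ 𝔮 := by
        intro 𝔮 h𝔮 hle
        obtain ⟨h1, -, h3, h4⟩ := h𝓠 𝔮 h𝔮
        obtain ⟨𝔓', h𝔓', h𝔓'le⟩ := Ideal.exists_minimalPrimes_le hle
        have hrel : ∀ j, (MvPolynomial.X j : MvPolynomial (Fin m) K) ∉ 𝔓' :=
          fun j hj => h3 j (h𝔓'le hj)
        have hdim := hmax 𝔓' h𝔓' hrel
        have hge : ringKrullDim (MvPolynomial (Fin m) K ⧸ 𝔮) ≤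
            ringKrullDim (MvPolynomial (Fin m) K ⧸ 𝔓') :=
          ringKrullDim_le_of_surjective (Ideal.Quotient.factor h𝔓'le)
            (Ideal.Quotient.factor_surjective _)
        rw [h4] at hge
        have := hge.trans hdim
        have : m - i ≤ a + 1 := by exact_mod_cast this
        exact absurd (hmi.trans this) (by norm_num)
      -- a form `Q ∈ 𝔞_D` outside every `𝔮 ∈ 𝓠`
      obtain ⟨Q, hQ𝔞D, hQ⟩ := exists_mem_forall_notMem_of_forall_not_le (K := K)
        (idealDegree 𝔞 D) (𝓠.image fun 𝔮 : Ideal (MvPolynomial (Fin m) K) => 𝔮.restrictScalars K)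
        (by
          intro W hW
          obtain ⟨𝔮, h𝔮, rfl⟩ := Finset.mem_image.mp hW
          haveI := (h𝓠 𝔮 h𝔮).1
          exact not_idealDegree_le_of_not_le hG hGdeg ((h𝓠 𝔮 h𝔮).2.2.1 ⟨0, hm⟩) (hnot 𝔮 h𝔮))
      have hQ𝓠 : ∀ 𝔮 ∈ 𝓠, Q ∉ 𝔮 := fun 𝔮 h𝔮 =>
        hQ (𝔮.restrictScalars K) (Finset.mem_image_of_mem _ h𝔮)
      obtain ⟨𝔮₀, h𝔮₀⟩ := h𝓠ne
      have hQ0 : Q ≠ 0 := fun h => hQ𝓠 𝔮₀ h𝔮₀ (h ▸ Submodule.zero_mem _)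
      have hQD : Q.IsHomogeneous D := hQ𝔞D.2
      have hQ𝔞 : Q ∈ 𝔞 := hQ𝔞D.1
      -- `K = ⋂𝓠`
      have hKhom : (𝓠.inf id).IsHomogeneous (MvPolynomial.homogeneousSubmodule (Fin m) K) :=
        isHomogeneous_finset_inf fun 𝔮 h𝔮 => (h𝓠 𝔮 h𝔮).2.1
      have hnzd : ∀ f, Q * f ∈ 𝓠.inf id → f ∈ 𝓠.inf id :=
        mem_finset_inf_of_mul_mem (fun 𝔮 h𝔮 => (h𝓠 𝔮 h𝔮).1) hQ𝓠
      have hKdim : ringKrullDim (MvPolynomial (Fin m) K ⧸ 𝓠.inf id) = (m - i : ℕ) :=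
        ringKrullDim_quotient_finset_inf ⟨𝔮₀, h𝔮₀⟩ fun 𝔮 h𝔮 => (h𝓠 𝔮 h𝔮).2.2.2
      have hKQhom : (𝓠.inf id ⊔ Ideal.span {Q}).IsHomogeneous
          (MvPolynomial.homogeneousSubmodule (Fin m) K) :=
        hKhom.sup (isHomogeneous_span_singleton hQD)
      -- the next family
      set 𝓠' : Finset (Ideal (MvPolynomial (Fin m) K)) :=
        (Ideal.finite_minimalPrimes_of_isNoetherianRing _ (𝓠.inf id ⊔ Ideal.span {Q})).toFinset.filter
          fun 𝔮' => (∀ j, (MvPolynomial.X j : MvPolynomial (Fin m) K) ∉ 𝔮') ∧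
            ringKrullDim (MvPolynomial (Fin m) K ⧸ 𝔮') = (m - (i + 1) : ℕ) with h𝓠'def
      have hmem𝓠' : ∀ 𝔮', 𝔮' ∈ 𝓠' ↔ 𝔮' ∈ (𝓠.inf id ⊔ Ideal.span {Q}).minimalPrimes ∧
          (∀ j, (MvPolynomial.X j : MvPolynomial (Fin m) K) ∉ 𝔮') ∧
          ringKrullDim (MvPolynomial (Fin m) K ⧸ 𝔮') = (m - (i + 1) : ℕ) := fun 𝔮' => by
        simp only [h𝓠'def, Finset.mem_filter, Set.Finite.mem_toFinset]
      -- every `𝔓 ∈ 𝓟` contains a member of `𝓠'`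
      have hcov' : ∀ 𝔓 ∈ 𝓟, ∃ 𝔮' ∈ 𝓠', 𝔮' ≤ 𝔓 := by
        intro 𝔓 h𝔓
        obtain ⟨h𝔓min, h𝔓rel, h𝔓dim⟩ := h𝓟 𝔓 h𝔓
        haveI : 𝔓.IsPrime := h𝔓min.1.1
        obtain ⟨𝔮, h𝔮, h𝔮𝔓⟩ := hcov 𝔓 h𝔓
        have hKQ : 𝓠.inf id ⊔ Ideal.span {Q} ≤ 𝔓 :=
          sup_le ((Finset.inf_le h𝔮).trans h𝔮𝔓)
            ((Ideal.span_singleton_le_iff_mem _).mpr (h𝔓min.1.2 hQ𝔞))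
        obtain ⟨𝔮', h𝔮'min, h𝔮'𝔓⟩ := Ideal.exists_minimalPrimes_le hKQ
        have h𝔮'prime : 𝔮'.IsPrime := h𝔮'min.1.1
        refine ⟨𝔮', (hmem𝓠' 𝔮').mpr ⟨h𝔮'min, fun j hj => h𝔓rel j (h𝔮'𝔓 hj), ?_⟩, h𝔮'𝔓⟩
        -- dimension of `𝔮'`: it is minimal over `𝔮₁ + (Q)` for some `𝔮₁ ∈ 𝓠`
        obtain ⟨𝔮₁, h𝔮₁, h𝔮₁le⟩ :=
          (Ideal.IsPrime.inf_le' h𝔮'prime).mp (le_sup_left.trans h𝔮'min.1.2)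
        haveI := (h𝓠 𝔮₁ h𝔮₁).1
        have hmin₁ : 𝔮' ∈ (𝔮₁ ⊔ Ideal.span {Q}).minimalPrimes := by
          refine ⟨⟨h𝔮'prime, sup_le h𝔮₁le (le_sup_right.trans h𝔮'min.1.2)⟩, ?_⟩
          intro P' hP' hP'le
          exact h𝔮'min.2 ⟨hP'.1, (sup_le_sup_right (Finset.inf_le h𝔮₁) _).trans hP'.2⟩ hP'le
        have hA7 := ringKrullDim_quotient_add_one_of_mem_minimalPrimes_sup_span (hQ𝓠 𝔮₁ h𝔮₁) hmin₁
        rw [(h𝓠 𝔮₁ h𝔮₁).2.2.2, hA2] at hA7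
        exact ENat.WithBot.add_natCast_cancel.mp hA7
      have h𝓠'ne : 𝓠'.Nonempty := by
        obtain ⟨𝔮', h𝔮', -⟩ := hcov' 𝔓₀ h𝔓₀
        exact ⟨𝔮', h𝔮'⟩
      have h𝓠'prop : ∀ 𝔮' ∈ 𝓠', 𝔮'.IsPrime ∧
          𝔮'.IsHomogeneous (MvPolynomial.homogeneousSubmodule (Fin m) K) ∧
          (∀ j, (MvPolynomial.X j : MvPolynomial (Fin m) K) ∉ 𝔮') ∧
          ringKrullDim (MvPolynomial (Fin m) K ⧸ 𝔮') = (m - (i + 1) : ℕ) := by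
        intro 𝔮' h𝔮'
        obtain ⟨hmin, hrel, hdim⟩ := (hmem𝓠' 𝔮').mp h𝔮'
        exact ⟨hmin.1.1, isHomogeneous_of_mem_minimalPrimes hKQhom hmin, hrel, hdim⟩
      -- Hilbert polynomial of `K' = ⋂𝓠'`
      have hK'hom : (𝓠'.inf id).IsHomogeneous (MvPolynomial.homogeneousSubmodule (Fin m) K) :=
        isHomogeneous_finset_inf fun 𝔮' h𝔮' => (h𝓠'prop 𝔮' h𝔮').2.1
      obtain ⟨P', t₁, hP'⟩ := exists_hilbertPolynomial (𝓠'.inf id) hK'hom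
      have hK'dim : ringKrullDim (MvPolynomial (Fin m) K ⧸ 𝓠'.inf id) = (m - (i + 1) : ℕ) :=
        ringKrullDim_quotient_finset_inf h𝓠'ne fun 𝔮' h𝔮' => (h𝓠'prop 𝔮' h𝔮').2.2.2
      have hP'deg : P'.natDegree = m - (i + 1) - 1 := by
        have h := natDegree_hilbertPolynomial hK'hom (b := m - (i + 1) - 1)
          (by rw [hK'dim, ← hA3]) hP'
        exact h.1
      have hKK' : 𝓠.inf id ⊔ Ideal.span {Q} ≤ 𝓠'.inf id :=
        Finset.le_inf fun 𝔮' h𝔮' => ((hmem𝓠' 𝔮').mp h𝔮').1.1.2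
      have hlc := leadingCoeff_hilbertPolynomial_le_of_hypersurface hKhom hQ0 hQD hnzd hKK'
        (t₀ := max t₀ t₁) (fun t ht => hP t (le_of_max_le_left ht))
        (fun t ht => hP' t (le_of_max_le_right ht)) (by rw [hPdeg]; exact hA4)
        (by rw [hP'deg, hPdeg, hA5]) hD
      refine ⟨𝓠', h𝓠'ne, h𝓠'prop, hcov', P', t₁, hP', hP'deg, hlc.trans ?_⟩
      -- `D · (m-i-1) · D^i/(m-i-1)! = D^{i+1}/(m-i-2)!`
      rw [hPdeg]
      have hfac : (((m - i - 1).factorial : ℕ) : ℚ) =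
          ((m - i - 1 : ℕ) : ℚ) * (((m - (i + 1) - 1).factorial : ℕ) : ℚ) := by
        rw [hA6, Nat.factorial_succ]
        push_cast
        ring
      have hpos : (0 : ℚ) < ((m - i - 1 : ℕ) : ℚ) := by exact_mod_cast hA4
      have hfpos : (0 : ℚ) < (((m - (i + 1) - 1).factorial : ℕ) : ℚ) := by
        exact_mod_cast Nat.factorial_pos _
      have hDpos : (0 : ℚ) < (D : ℚ) := by exact_mod_cast hD
      calc (D : ℚ) * ((m - i - 1 : ℕ) : ℚ) * P.leadingCoeff
          ≤ (D : ℚ) * ((m - i - 1 : ℕ) : ℚ) * ((D : ℚ) ^ i * ((((m - i - 1).factorial : ℕ) : ℚ)⁻¹)) :=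
            mul_le_mul_of_nonneg_left hPlc (mul_nonneg hDpos.le hpos.le)
        _ = (D : ℚ) ^ (i + 1) * ((((m - (i + 1) - 1).factorial : ℕ) : ℚ)⁻¹) := by
            rw [hfac]
            field_simp
            ring
  -- conclusion: at `i = r` the primes of `𝓟` are among `𝓠_r`
  obtain ⟨𝓠, h𝓠ne, h𝓠, hcov, P, t₀, hP, hPdeg, hPlc⟩ := key r le_rfl
  have hmr : m - r = a + 1 := by omega
  have hsub : 𝓟 ⊆ 𝓠 := by
    intro 𝔓 h𝔓
    obtain ⟨𝔮, h𝔮, h𝔮𝔓⟩ := hcov 𝔓 h𝔓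
    haveI := (h𝓠 𝔮 h𝔮).1
    haveI := (h𝓟 𝔓 h𝔓).1.1.1
    have hdim𝔮 := (h𝓠 𝔮 h𝔮).2.2.2
    rw [hmr] at hdim𝔮
    rwa [← eq_of_le_of_ringKrullDim_quotient_eq h𝔮𝔓 hdim𝔮 (h𝓟 𝔓 h𝔓).2.2]
  refine (Finset.card_le_card hsub).trans ?_
  -- `|𝓠| / a! ≤ coeff_a P = lc P ≤ D^r / a!`
  have hcount := card_mul_inv_factorial_le_coeff (K := K) (a := a) 𝓠 h𝓠ne
    (fun 𝔮 h𝔮 => ⟨(h𝓠 𝔮 h𝔮).1, (h𝓠 𝔮 h𝔮).2.1, by rw [(h𝓠 𝔮 h𝔮).2.2.2, hmr]⟩) P t₀ hP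
  have hdega : P.natDegree = a := by rw [hPdeg]; omega
  rw [show m - r - 1 = a by omega] at hPlc
  have hcoeff : P.coeff a = P.leadingCoeff := by rw [Polynomial.leadingCoeff, hdega]
  rw [hcoeff] at hcount
  have h := hcount.trans hPlc
  have hfpos : (0 : ℚ) < (((a.factorial : ℕ) : ℚ)) := by exact_mod_cast Nat.factorial_pos _
  have h' : (𝓠.card : ℚ) ≤ (D : ℚ) ^ r := by
    have := mul_le_mul_of_nonneg_right h hfpos.le
    rwa [mul_assoc, inv_mul_cancel₀ hfpos.ne', mul_one, mul_assoc, inv_mul_cancel₀ hfpos.ne',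
      mul_one] at this
  exact_mod_cast h'

end Literature.RingTheory.MvPolynomial

end
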